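import Literature.LinearAlgebra.Matrix.NonnegSymmetricTraceLimit

/-!
# Spectral weights of a pair of operators with respect to a nonnegative symmetric transfer
# matrix: the limit of `Tr(X Aᵏ Y Aˢ)/Tr(A^{s+r})`, reflection positivity and Cauchy–Schwarz

Topic `LinearAlgebra/Matrix`, namespace `Literature.LinearAlgebra.Matrix`; continues
`NonnegSymmetricTraceLimit.lean`. This is the finite-dimensional linear algebra behind the
**spectral representation of general observables** of Duminil-Copin–Kozlowski–Lammers–Manolescu
(arXiv:2603.06268 (2026), Theorem 26 and its proof in Part III §2), for a real symmetric matrix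
`A` (the transfer matrix `t(π/2)`, symmetric at `a = b`) with entries `≥ 0` and diagonal `≥ δ > 0`,
eigenvector matrix `U`, eigenvalues `λ_j`, top eigenvalue `Λ` of multiplicity `d`:

* `pairSpectralWeight hA X Y j = ∑_{i : λ_i = Λ} (UᵀXU)_{ij} (UᵀYU)_{ji}` — the weight of the atom
  at `1 - λ_j/Λ` of the (un-normalised) spectral measure `μ_{X,Y}` of DKLM's Step 1
  (`μ_{X,Y,L} := ∑_k (ℰ⁺(Y) v_k)(v_k† ℰ⁻(X)) δ_{1-Λ_k}`; here without assuming that the top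
  eigenvalue is simple, the rôle of `v_0 v_0†` being played by the projection onto the top
  eigenspace, averaged — this is what the `M → ∞` limit of the torus produces in general);
* `tendsto_trace_mul_pow_mul_mul_pow_div` — **Theorem 26 (i) at the operator level**:
  `Tr(X Aᵏ Y Aˢ) / Tr(A^{s+r}) → (∑_j pairSpectralWeight X Y j · λ_jᵏ) / (d Λ^r)` as `s → ∞`
  (so that, after normalising by `Λ^k`, the cylinder correlation `𝔼[X · τ_k Y]` is
  `∫ (1-a)^k dμ_{X,Y}(a)` with `μ_{X,Y} = ∑_j c_j δ_{1-λ_j/Λ}`), and the support statement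
  `neg_one_lt_eigenvalues_div_topEigenvalue`, `eigenvalues_div_topEigenvalue_le_one`
  (`1 - λ_j/Λ ∈ [0, 2)`: `-Λ` is not an eigenvalue, `NonnegSymmetricTraceLimit.lean`);
* `pairSpectralWeight_transpose_right` / `_left` and `pairSpectralWeight_transpose_nonneg` —
  **Theorem 26 (ii), positivity**: `μ_{X,Xᵀ}` and `μ_{Yᵀ,Y}` are positive (DKLM Step 3: reflection
  symmetry `𝔬_{X†} = 𝔬_X†` turns the weights into sums of squares);
* `sq_sum_abs_pairSpectralWeight_le` — **Theorem 26 (ii), the Cauchy–Schwarz inequality**: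
  `(∑_j |c_j(X,Y)|)² ≤ (∑_j c_j(X,Xᵀ)) (∑_j c_j(Yᵀ,Y))` (total variation of `μ_{X,Y}` squared is
  at most `‖μ_{X,X†}‖ ‖μ_{Y†,Y}‖`).

## References

* H. Duminil-Copin, K. K. Kozlowski, P. Lammers, I. Manolescu, *Gaussian free field convergence of
  the six-vertex model with `-1 ≤ Δ ≤ -1/2`*, arXiv:2603.06268 (2026), Theorem 26 and Part III
  §2 (Steps 1–3 of its proof). [DKLM2026SixVertexGFF]
* J. Ding, A. Zhou, *Nonnegative Matrices, Positive Operators, and Applications* (2009), §2.1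
  (the spectral input, via `NonnegSymmetricTraceLimit.lean`). [DingZhou2009]
-/

noncomputable section

open Matrix Finset Filter Topology

namespace Literature.LinearAlgebra.Matrix

variable {n : Type*} [Fintype n] [DecidableEq n] {A : Matrix n n ℝ}

/-! ### Spectral coordinates of `X Aᵏ Y` -/

/-- `U (Uᵀ Z) = Z`. [folklore] -/
theorem eigU_mul_star_eigU_mul (hA : A.IsHermitian) (Z : Matrix n n ℝ) :
    eigU hA * (star (eigU hA) * Z) = Z := by
  rw [← Matrix.mul_assoc, eigU_mul_star, Matrix.one_mul]

/-- `Uᵀ Aᵏ U = diag(λᵏ)`. [folklore] -/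
theorem star_eigU_mul_pow_mul_eigU (hA : A.IsHermitian) (k : ℕ) :
    star (eigU hA) * A ^ k * eigU hA = diagonal (fun i => hA.eigenvalues i ^ k) := by
  rw [pow_eq_eigU_mul hA k, ← Matrix.mul_assoc, ← Matrix.mul_assoc, star_eigU_mul, Matrix.one_mul,
    Matrix.mul_assoc, star_eigU_mul, Matrix.mul_one]

/-- `Uᵀ (X Aᵏ Y) U = (UᵀXU) diag(λᵏ) (UᵀYU)`. [folklore] -/
theorem star_eigU_mul_mul_pow_mul_mul_eigU (hA : A.IsHermitian) (X Y : Matrix n n ℝ) (k : ℕ) :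
    star (eigU hA) * (X * A ^ k * Y) * eigU hA =
      star (eigU hA) * X * eigU hA * diagonal (fun i => hA.eigenvalues i ^ k) *
        (star (eigU hA) * Y * eigU hA) := by
  rw [← star_eigU_mul_pow_mul_eigU hA k]
  simp only [Matrix.mul_assoc, eigU_mul_star_eigU_mul]

/-- The diagonal entries of `Uᵀ (X Aᵏ Y) U`:
`(Uᵀ X Aᵏ Y U)_{ii} = ∑_j (UᵀXU)_{ij} λ_jᵏ (UᵀYU)_{ji}`. [folklore] -/
theorem star_eigU_mul_mul_pow_mul_mul_eigU_apply (hA : A.IsHermitian) (X Y : Matrix n n ℝ)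
    (k : ℕ) (i : n) :
    (star (eigU hA) * (X * A ^ k * Y) * eigU hA) i i =
      ∑ j, (star (eigU hA) * X * eigU hA) i j * hA.eigenvalues j ^ k *
        (star (eigU hA) * Y * eigU hA) j i := by
  rw [star_eigU_mul_mul_pow_mul_mul_eigU, Matrix.mul_apply]
  refine Finset.sum_congr rfl fun j _ => ?_
  rw [Matrix.mul_diagonal]

/-- Conjugating a transpose: `(UᵀXᵀU)_{ji} = (UᵀXU)_{ij}` (`U` is real orthogonal). [folklore] -/
theorem star_eigU_mul_transpose_mul_eigU_apply (hA : A.IsHermitian) (X : Matrix n n ℝ) (i j : n) :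
    (star (eigU hA) * Xᵀ * eigU hA) j i = (star (eigU hA) * X * eigU hA) i j := by
  have h : star (eigU hA) * Xᵀ * eigU hA = (star (eigU hA) * X * eigU hA)ᵀ := by
    rw [Matrix.transpose_mul, Matrix.transpose_mul, star_eq_conjTranspose,
      conjTranspose_eq_transpose_of_trivial, Matrix.transpose_transpose, Matrix.mul_assoc]
  rw [h, Matrix.transpose_apply]

/-! ### The spectral weights of a pair of operators -/

/-- **The spectral weights of the pair `(X, Y)`**: the weight
`c_j(X, Y) = ∑_{i : λ_i = Λ} (UᵀXU)_{ij} (UᵀYU)_{ji}` of the atom at `1 - λ_j/Λ` of the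
(un-normalised) spectral measure `μ_{X,Y}` (DKLM, proof of Thm 26, Step 1, with the projection onto
the top eigenspace in place of `v_0 v_0†`). [cite: DKLM2026SixVertexGFF, Part III §2, Step 1] -/
def pairSpectralWeight [Nonempty n] (hA : A.IsHermitian) (X Y : Matrix n n ℝ) (j : n) : ℝ :=
  ∑ i ∈ univ.filter (fun i => hA.eigenvalues i = topEigenvalue hA),
    (star (eigU hA) * X * eigU hA) i j * (star (eigU hA) * Y * eigU hA) j i

/-- The top-eigenspace diagonal sum of `Uᵀ (X Aᵏ Y) U` is the `k`-th moment of the spectral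
weights: `∑_{i : λ_i = Λ} (Uᵀ X Aᵏ Y U)_{ii} = ∑_j c_j(X,Y) λ_jᵏ`. [cite: DKLM2026SixVertexGFF, Part III §2, Step 2] -/
theorem sum_filter_star_eigU_mul_mul_pow_mul_mul_eigU_apply [Nonempty n] (hA : A.IsHermitian)
    (X Y : Matrix n n ℝ) (k : ℕ) :
    ∑ i ∈ univ.filter (fun i => hA.eigenvalues i = topEigenvalue hA),
        (star (eigU hA) * (X * A ^ k * Y) * eigU hA) i i =
      ∑ j, pairSpectralWeight hA X Y j * hA.eigenvalues j ^ k := by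
  simp only [pairSpectralWeight, star_eigU_mul_mul_pow_mul_mul_eigU_apply, Finset.sum_mul]
  rw [Finset.sum_comm]
  refine Finset.sum_congr rfl fun j _ => Finset.sum_congr rfl fun i _ => ?_
  ring

/-- **Theorem 26 (i) at the operator level.** For a real symmetric `A` with nonnegative entries
and diagonal `≥ δ > 0`, any matrices `X, Y` and any `k, r`:
`Tr(X Aᵏ Y Aˢ) / Tr(A^{s+r}) → (∑_j c_j(X,Y) λ_jᵏ) / (d Λ^r)` as `s → ∞`, `d` the multiplicity of
the top eigenvalue `Λ`. With `r = r_X + k + r_Y` this is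
`𝔼[X · τ_k Y] = ∑_j (c_j(X,Y) / (d Λ^{r_X + r_Y})) (1 - a_j)^k`, `a_j = 1 - λ_j/Λ ∈ [0, 2)`:
the spectral representation `∫ (1-a)^k dμ_{X,Y}(a)`. [cite: DKLM2026SixVertexGFF, Theorem 26 (i) and Part III §2, Step 2] -/
theorem tendsto_trace_mul_pow_mul_mul_pow_div [Nonempty n] (hA : A.IsHermitian)
    (hA0 : ∀ i j, i ≠ j → 0 ≤ A i j) {δ : ℝ} (hδ : 0 < δ) (hdiag : ∀ i, δ ≤ A i i)
    (X Y : Matrix n n ℝ) (k r : ℕ) :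
    Tendsto (fun s : ℕ => (X * A ^ k * Y * A ^ s).trace / (A ^ (s + r)).trace) atTop
      (𝓝 ((∑ j, pairSpectralWeight hA X Y j * hA.eigenvalues j ^ k) /
        ((univ.filter fun i => hA.eigenvalues i = topEigenvalue hA).card *
          topEigenvalue hA ^ r))) := by
  rw [← sum_filter_star_eigU_mul_mul_pow_mul_mul_eigU_apply hA X Y k]
  exact tendsto_trace_mul_pow_div_trace_pow_add hA hA0 hδ hdiag (X * A ^ k * Y) r

/-- The same limit written with the normalised atoms `λ_j/Λ = 1 - a_j`:
`Tr(X Aᵏ Y Aˢ) / Tr(A^{s+(r+k)}) → (∑_j c_j(X,Y) (λ_j/Λ)ᵏ) / (d Λ^r)`.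
[cite: DKLM2026SixVertexGFF, Theorem 26 (i)] -/
theorem tendsto_trace_mul_pow_mul_mul_pow_div' [Nonempty n] (hA : A.IsHermitian)
    (hA0 : ∀ i j, i ≠ j → 0 ≤ A i j) {δ : ℝ} (hδ : 0 < δ) (hdiag : ∀ i, δ ≤ A i i)
    (X Y : Matrix n n ℝ) (k r : ℕ) :
    Tendsto (fun s : ℕ => (X * A ^ k * Y * A ^ s).trace / (A ^ (s + (r + k))).trace) atTop
      (𝓝 ((∑ j, pairSpectralWeight hA X Y j * (hA.eigenvalues j / topEigenvalue hA) ^ k) /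
        ((univ.filter fun i => hA.eigenvalues i = topEigenvalue hA).card *
          topEigenvalue hA ^ r))) := by
  have h := tendsto_trace_mul_pow_mul_mul_pow_div hA hA0 hδ hdiag X Y k (r + k)
  convert h using 2
  have hsum : ∑ j, pairSpectralWeight hA X Y j * (hA.eigenvalues j / topEigenvalue hA) ^ k =
      (∑ j, pairSpectralWeight hA X Y j * hA.eigenvalues j ^ k) / topEigenvalue hA ^ k := by
    rw [Finset.sum_div]
    refine Finset.sum_congr rfl fun j _ => ?_
    rw [div_pow, mul_div_assoc]
  rw [hsum, div_div, pow_add]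
  congr 1
  ring

/-! ### The support of the spectral measure: `1 - λ_j/Λ ∈ [0, 2)` -/

/-- `λ_j / Λ ≤ 1`. [folklore] -/
theorem eigenvalues_div_topEigenvalue_le_one [Nonempty n] (hA : A.IsHermitian) {δ : ℝ} (hδ : 0 < δ)
    (hdiag : ∀ i, δ ≤ A i i) (j : n) : hA.eigenvalues j / topEigenvalue hA ≤ 1 := by
  rw [div_le_one (topEigenvalue_pos_of_diag hA hδ hdiag)]
  exact eigenvalues_le_topEigenvalue hA j

/-- `-1 < λ_j / Λ`: `-Λ` is not an eigenvalue, so the spectral measure lives on `[0, 2)`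
(DKLM Remark 58, here from positivity of the diagonal instead of Perron–Frobenius).
[cite: DKLM2026SixVertexGFF, Remark 58] -/
theorem neg_one_lt_eigenvalues_div_topEigenvalue [Nonempty n] (hA : A.IsHermitian)
    (hA0 : ∀ i j, i ≠ j → 0 ≤ A i j) {δ : ℝ} (hδ : 0 < δ) (hdiag : ∀ i, δ ≤ A i i) (j : n) :
    -1 < hA.eigenvalues j / topEigenvalue hA := by
  by_cases h : hA.eigenvalues j = topEigenvalue hA
  · rw [h, div_self (topEigenvalue_pos_of_diag hA hδ hdiag).ne']
    norm_num
  · exact (abs_lt.mp (abs_div_topEigenvalue_lt_one hA hA0 hδ hdiag h)).1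

/-- The atoms `a_j = 1 - λ_j/Λ` of the spectral measure lie in `[0, 2)`.
[cite: DKLM2026SixVertexGFF, Theorem 26 ("supported on `[0,2)`")] -/
theorem one_sub_eigenvalues_div_topEigenvalue_mem_Ico [Nonempty n] (hA : A.IsHermitian)
    (hA0 : ∀ i j, i ≠ j → 0 ≤ A i j) {δ : ℝ} (hδ : 0 < δ) (hdiag : ∀ i, δ ≤ A i i) (j : n) :
    1 - hA.eigenvalues j / topEigenvalue hA ∈ Set.Ico (0 : ℝ) 2 := by
  have h1 := eigenvalues_div_topEigenvalue_le_one hA hδ hdiag j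
  have h2 := neg_one_lt_eigenvalues_div_topEigenvalue hA hA0 hδ hdiag j
  constructor <;> linarith

/-! ### Reflection positivity and the Cauchy–Schwarz inequality (Theorem 26 (ii)) -/

/-- **Positivity under reflection, right**: `c_j(X, Xᵀ) = ∑_{i : λ_i = Λ} (UᵀXU)_{ij}²`.
[cite: DKLM2026SixVertexGFF, Part III §2, Step 3] -/
theorem pairSpectralWeight_transpose_right [Nonempty n] (hA : A.IsHermitian) (X : Matrix n n ℝ)
    (j : n) :
    pairSpectralWeight hA X Xᵀ j =
      ∑ i ∈ univ.filter (fun i => hA.eigenvalues i = topEigenvalue hA),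
        (star (eigU hA) * X * eigU hA) i j ^ 2 := by
  unfold pairSpectralWeight
  refine Finset.sum_congr rfl fun i _ => ?_
  rw [star_eigU_mul_transpose_mul_eigU_apply, sq]

/-- **Positivity under reflection, left**: `c_j(Yᵀ, Y) = ∑_{i : λ_i = Λ} (UᵀYU)_{ji}²`.
[cite: DKLM2026SixVertexGFF, Part III §2, Step 3] -/
theorem pairSpectralWeight_transpose_left [Nonempty n] (hA : A.IsHermitian) (Y : Matrix n n ℝ)
    (j : n) :
    pairSpectralWeight hA Yᵀ Y j =
      ∑ i ∈ univ.filter (fun i => hA.eigenvalues i = topEigenvalue hA),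
        (star (eigU hA) * Y * eigU hA) j i ^ 2 := by
  unfold pairSpectralWeight
  refine Finset.sum_congr rfl fun i _ => ?_
  rw [← star_eigU_mul_transpose_mul_eigU_apply hA Y, sq]

/-- **Theorem 26 (ii), positivity**: the spectral measures `μ_{X,Xᵀ}` and `μ_{Yᵀ,Y}` are positive.
[cite: DKLM2026SixVertexGFF, Theorem 26 (ii)] -/
theorem pairSpectralWeight_transpose_nonneg [Nonempty n] (hA : A.IsHermitian) (X : Matrix n n ℝ)
    (j : n) : 0 ≤ pairSpectralWeight hA X Xᵀ j ∧ 0 ≤ pairSpectralWeight hA Xᵀ X j := by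
  refine ⟨?_, ?_⟩
  · rw [pairSpectralWeight_transpose_right]
    exact Finset.sum_nonneg fun i _ => sq_nonneg _
  · rw [pairSpectralWeight_transpose_left]
    exact Finset.sum_nonneg fun i _ => sq_nonneg _

/-- Pointwise Cauchy–Schwarz for the weights:
`|c_j(X,Y)| ≤ √(c_j(X,Xᵀ)) · √(c_j(Yᵀ,Y))`. [cite: DKLM2026SixVertexGFF, Part III §2, Step 3] -/
theorem abs_pairSpectralWeight_le [Nonempty n] (hA : A.IsHermitian) (X Y : Matrix n n ℝ) (j : n) :
    |pairSpectralWeight hA X Y j| ≤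
      Real.sqrt (pairSpectralWeight hA X Xᵀ j) * Real.sqrt (pairSpectralWeight hA Yᵀ Y j) := by
  rw [pairSpectralWeight_transpose_right, pairSpectralWeight_transpose_left,
    ← Real.sqrt_mul (Finset.sum_nonneg fun i _ => sq_nonneg _), ← Real.sqrt_sq_eq_abs]
  exact Real.sqrt_le_sqrt (Finset.sum_mul_sq_le_sq_mul_sq _ _ _)

/-- **Theorem 26 (ii), the Cauchy–Schwarz inequality**:
`(∑_j |c_j(X,Y)|)² ≤ (∑_j c_j(X,Xᵀ)) · (∑_j c_j(Yᵀ,Y))`, i.e.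
`‖μ_{X,Y}‖² ≤ ‖μ_{X,X†}‖ ‖μ_{Y†,Y}‖ = 𝔼[X X†] 𝔼[Y† Y]` (the common normalisation
`d Λ^{r_X + r_Y}` cancels). [cite: DKLM2026SixVertexGFF, Theorem 26 (ii)] -/
theorem sq_sum_abs_pairSpectralWeight_le [Nonempty n] (hA : A.IsHermitian) (X Y : Matrix n n ℝ) :
    (∑ j, |pairSpectralWeight hA X Y j|) ^ 2 ≤
      (∑ j, pairSpectralWeight hA X Xᵀ j) * ∑ j, pairSpectralWeight hA Yᵀ Y j := by
  have hp : ∀ j, 0 ≤ pairSpectralWeight hA X Xᵀ j := fun j =>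
    (pairSpectralWeight_transpose_nonneg hA X j).1
  have hq : ∀ j, 0 ≤ pairSpectralWeight hA Yᵀ Y j := fun j => by
    have h := (pairSpectralWeight_transpose_nonneg hA Yᵀ j).1
    rwa [Matrix.transpose_transpose] at h
  calc (∑ j, |pairSpectralWeight hA X Y j|) ^ 2
      ≤ (∑ j, Real.sqrt (pairSpectralWeight hA X Xᵀ j) *
          Real.sqrt (pairSpectralWeight hA Yᵀ Y j)) ^ 2 :=
        pow_le_pow_left₀ (Finset.sum_nonneg fun j _ => abs_nonneg _)
          (Finset.sum_le_sum fun j _ => abs_pairSpectralWeight_le hA X Y j) 2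
    _ ≤ (∑ j, Real.sqrt (pairSpectralWeight hA X Xᵀ j) ^ 2) *
          ∑ j, Real.sqrt (pairSpectralWeight hA Yᵀ Y j) ^ 2 :=
        Finset.sum_mul_sq_le_sq_mul_sq _ _ _
    _ = (∑ j, pairSpectralWeight hA X Xᵀ j) * ∑ j, pairSpectralWeight hA Yᵀ Y j := by
        congr 1
        · exact Finset.sum_congr rfl fun j _ => Real.sq_sqrt (hp j)
        · exact Finset.sum_congr rfl fun j _ => Real.sq_sqrt (hq j)

/-- The total mass `|∑_j c_j(X,Y)| ≤ ∑_j |c_j(X,Y)|` — `|𝔼[XY]| ≤ ‖μ_{X,Y}‖`, the first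
inequality of Theorem 26 (ii). [cite: DKLM2026SixVertexGFF, Theorem 26 (ii)] -/
theorem abs_sum_pairSpectralWeight_le [Nonempty n] (hA : A.IsHermitian) (X Y : Matrix n n ℝ) :
    |∑ j, pairSpectralWeight hA X Y j| ≤ ∑ j, |pairSpectralWeight hA X Y j| :=
  Finset.abs_sum_le_sum_abs _ _

end Literature.LinearAlgebra.Matrix

end
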